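import Literature.AnabelianGeometry.SemiGraphs.ProSigmaSurfaceCharacters
import Literature.AnabelianGeometry.SemiGraphs.ProSigmaCompletionLifting
import Literature.AnabelianGeometry.SemiGraphs.ProSigmaCompletionProfiniteExtend
import Literature.AnabelianGeometry.AbsoluteAnabelian.FreeProlRankCompletionProofs
import Literature.AnabelianGeometry.AbsoluteAnabelian.FreeProcyclicModel
import Literature.GroupTheory.CombinatorialGroupTheory.SurfaceGroupFiniteIndexSubgroupHolds
import Literature.Topology.FourManifolds.SurfaceGroupGenusOne
import HarnessLib

/-!
# The free pro-`ℓ` rank of the open subgroups of a pro-`Σ` surface group: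
# `δ¹_ℓ(U) = 2(g - 1)·[P : U] + 2` ([AbsTopI] Prop 2.3 (i) / [MT] Thm 1.5, rank input)

Topic `AnabelianGeometry/SemiGraphs`, namespace
`Literature.AnabelianGeometry.SemiGraphs.SemiGraphOfAnabelioids.IsProSigmaCompletion` (next to
`ProSigmaClosedSurfaceSlim.lean`, the SLIM half of [AbsTopI] Prop 2.3 (i) at the pro-`Σ` surface-group
model).  THEOREMS ONLY (no definition, no named fact).

Let `ι : Γ → P` be a pro-`Σ` completion (abc-iut-L3-t1's `IsProSigmaCompletion Sigma ι`, `P` profinite)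
of `Γ ≅ S_g`, the surface group of genus `g ≥ 2`, and let `ℓ ∈ Σ` be prime.  S. Mochizuki, *Topics in
Absolute Anabelian Geometry I* (2012) [AbsTopI], Prop 2.3 (i) p. 19 ("`Δ` is slim and elastic") rests, in
the rank route of the abc-iut cell (L4-lead RULING #4g 2026-08-26), on the LINEAR RANK FORMULA for the
open subgroups `U ⊆ P`:

  `δ¹_ℓ(U) = 2·(g − 1)·[P : U] + 2`   (`freeProlRank_open_eq_of_surfaceGroup`),

`δ¹_ℓ = freeProlRank` the tree's free pro-`ℓ` rank ([AbsTopI] Thm 2.6).  Proof: `[Γ : ι⁻¹U] = [P : U]`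
(`index_comap_of_isOpen`); `ι⁻¹U ≅ S_h` with `h = [P : U](g − 1) + 1` (F_cov, the tree's PROVED
`surfaceGroupFiniteIndexSubgroup_holds`, Zieschang–Vogt–Coldewey 4.14.22); `ι⁻¹U → U` is again a pro-`Σ`
completion (abc-iut-L5-t9's `restrict_isOpen`); and for ANY pro-`Σ` completion `Q` of `S_h`
(`freeProlRank_eq_of_surfaceGroup`): `δ¹_ℓ(Q) ≤ 2h` because `Q` is topologically generated by the images
of the `2h` standard generators (tree `freeProlRank_le_card`), and `δ¹_ℓ(Q) ≥ 2h` because the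
abelianisation `S_h → ℤ^{2h} ⊆ ℤ_ℓ^{2h}` extends continuously to `Q` (universal property for the
pro-`Σ` target `ℤ_ℓ^{2h}`, abc-iut-L3's `exists_continuous_extend_profinite`) with dense compact image.

Consumer: `ProSigmaClosedSurfaceElastic.lean` (elasticity of pro-`Σ` surface groups = the ELASTIC half
of [AbsTopI] Prop 2.3 (i) at the model, via the affine elasticity criterion of abc-iut-L4-t15/t16).
HONEST FRAMING: classical profinite/combinatorial group theory; nothing here bears on [IUTchIII]
Cor. 3.12; typed ≠ proved elsewhere.

## References

* S. Mochizuki, *Topics in Absolute Anabelian Geometry I: Generalities*, J. Math. Sci. Univ. Tokyo 19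
  (2012), Prop 2.3 (i) p. 19, Thm 2.6 p. 21. [MochizukiAbsTopI2012]
* S. Mochizuki, A. Tamagawa, *The algebraic and anabelian geometry of configuration spaces*, Hokkaido
  Math. J. 37 (2008), Thm 1.5 ([MT] of [AbsTopI]; no bib key in the tree — cited for orientation only).
* H. Zieschang, E. Vogt, H.-D. Coldewey, *Surfaces and Planar Discontinuous Groups*, LNM 835 (1980),
  4.14.22. [ZieschangVogtColdewey1980]
-/

noncomputable section

namespace Literature.AnabelianGeometry.SemiGraphs.SemiGraphOfAnabelioids.IsProSigmaCompletion

open Literature.AnabelianGeometry.Anabelioids Literature.AnabelianGeometry.AbsoluteAnabelian Topology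
open Literature.GroupTheory.CombinatorialGroupTheory
open Literature.Topology.FourManifolds (SurfaceGroup surfaceGen)

variable {Sigma : Set ℕ} {Γ : Type*} [Group Γ] {P : Type*} [Group P] [TopologicalSpace P]
  {ι : Γ →* P}

/-! ### Index of the pull-back of an open subgroup -/

/-- **`[Γ : ι⁻¹U] = [P : U]`** for an open subgroup `U` of a pro-`Σ` completion `ι : Γ → P` (the map of
coset spaces `Γ/ι⁻¹U → P/U` is injective by definition and surjective because every coset `pU` is open
and `ι(Γ)` is dense). [cite: MochizukiSemiAnbd2006, Ex. 2.10 p.31] -/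
theorem index_comap_of_isOpen [IsTopologicalGroup P] (hι : IsProSigmaCompletion Sigma ι)
    (U : Subgroup P) (hU : IsOpen (U : Set P)) : (U.comap ι).index = U.index := by
  classical
  let φ : Γ ⧸ U.comap ι → P ⧸ U :=
    Quotient.map' ι fun a b h => by
      rw [QuotientGroup.leftRel_apply] at h ⊢
      simpa using h
  have hφ : Function.Bijective φ := by
    constructor
    · intro x y hxy
      induction x using Quotient.inductionOn' with
      | h a =>
        induction y using Quotient.inductionOn' with
        | h b =>
          have h1 : (QuotientGroup.mk (ι a) : P ⧸ U) = QuotientGroup.mk (ι b) := hxy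
          rw [QuotientGroup.eq] at h1
          apply Quotient.sound'
          rw [QuotientGroup.leftRel_apply, Subgroup.mem_comap, map_mul, map_inv]
          exact h1
    · intro x
      induction x using Quotient.inductionOn' with
      | h p =>
        -- the open coset `p U` meets the dense `ι(Γ)`
        have hopen : IsOpen ((fun u => p * u) '' (U : Set P)) := (Homeomorph.mulLeft p).isOpenMap _ hU
        obtain ⟨_, ⟨u, hu, rfl⟩, γ, hγ⟩ := hι.dense.inter_open_nonempty _ hopen ⟨p * 1, 1, U.one_mem, rfl⟩
        refine ⟨Quotient.mk'' γ, ?_⟩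
        change (QuotientGroup.mk (ι γ) : P ⧸ U) = QuotientGroup.mk p
        rw [QuotientGroup.eq, hγ]
        simpa using U.inv_mem hu
  exact Nat.card_eq_of_bijective φ hφ

section Profinite

variable [IsTopologicalGroup P] [CompactSpace P] [TotallyDisconnectedSpace P]

/-! ### `δ¹_ℓ` of a pro-`Σ` surface group -/

/-- Open subgroups of `ℤ_ℓⁿ` (written multiplicatively) have `Σ`-integer index when `ℓ ∈ Σ` (their
index is a power of `ℓ`: tree `not_dvd_index_of_isOpen_padicPi`). [folklore] -/
private theorem isSigmaInteger_index_padicPi {ℓ : ℕ} [hℓ : Fact ℓ.Prime] (hℓS : ℓ ∈ Sigma) (n : ℕ)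
    (V : Subgroup (Multiplicative (Fin n → ℤ_[ℓ])))
    (hV : IsOpen (V : Set (Multiplicative (Fin n → ℤ_[ℓ])))) : IsSigmaInteger Sigma V.index := by
  haveI : Finite (Multiplicative (Fin n → ℤ_[ℓ]) ⧸ V) := Subgroup.quotient_finite_of_isOpen V hV
  haveI : V.FiniteIndex := Subgroup.finiteIndex_of_finite_quotient
  refine ⟨Nat.pos_of_ne_zero Subgroup.FiniteIndex.index_ne_zero, fun q hq hqd => ?_⟩
  by_contra hqS
  have hqℓ : q ≠ ℓ := fun h => hqS (h ▸ hℓS)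
  exact not_dvd_index_of_isOpen_padicPi (fun _ : Fin n => ℓ) hq (fun _ => hqℓ.symm) V hV hqd

omit [TotallyDisconnectedSpace P] in
/-- **`δ¹_ℓ(Q) = 2h` for every pro-`Σ` completion `Q` of the surface group `S_h`, `ℓ ∈ Σ`.**  Upper
bound: `Q` is topologically generated by the images of the `2h` standard generators
(`freeProlRank_le_card`).  Lower bound: the homomorphism `S_h → ℤ_ℓ^{2h}` sending the standard
generators to the standard basis extends continuously to `Q` (`exists_continuous_extend_profinite`, the
target being pro-`ℓ`), and the extension is surjective since its compact image contains the dense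
lattice `ℤ^{2h}`. [cite: MochizukiAbsTopI2012, Prop 2.3 (i) p.19] -/
theorem freeProlRank_eq_of_surfaceGroup (hι : IsProSigmaCompletion Sigma ι) {h : ℕ}
    (e : Γ ≃* SurfaceGroup h) {ℓ : ℕ} [hℓ : Fact ℓ.Prime] (hℓS : ℓ ∈ Sigma) :
    freeProlRank P ℓ = ((2 * h : ℕ) : ℕ∞) := by
  classical
  have hcard : Fintype.card (surfaceGen h) = 2 * h := by
    simp [surfaceGen, Fintype.card_prod, Fintype.card_bool, mul_comm]
  refine le_antisymm ?_ ?_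
  · -- `≤ 2h`: the images of the generators generate a dense subgroup
    let s : Finset P := Finset.univ.image fun x : surfaceGen h => ι (e.symm (PresentedGroup.of x))
    have hs : (Subgroup.closure (s : Set P)).topologicalClosure = ⊤ := by
      have hcl : Subgroup.closure (s : Set P) = ι.range := by
        rw [Finset.coe_image, Finset.coe_univ, Set.image_univ,
          show (Set.range fun x : surfaceGen h => ι (e.symm (PresentedGroup.of x))) =
            (ι.comp e.symm.toMonoidHom) '' Set.range (PresentedGroup.of : surfaceGen h → SurfaceGroup h)
            from by rw [← Set.range_comp]; rfl,
          ← MonoidHom.map_closure, PresentedGroup.closure_range_of, ← MonoidHom.range_eq_map,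
          MonoidHom.range_eq_map, MonoidHom.range_eq_map, ← Subgroup.map_map,
          ← MonoidHom.range_eq_map e.symm.toMonoidHom,
          MonoidHom.range_eq_top.mpr e.symm.surjective]
      rw [hcl, ← SetLike.coe_set_eq, Subgroup.topologicalClosure_coe, Subgroup.coe_top,
        MonoidHom.coe_range]
      exact hι.dense.closure_eq
    calc freeProlRank P ℓ ≤ s.card := freeProlRank_le_card s hs ℓ
      _ ≤ ((2 * h : ℕ) : ℕ∞) := by
          rw [← hcard]
          exact_mod_cast Finset.card_image_le.trans (Finset.card_univ (α := surfaceGen h)).le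
  · -- `≥ 2h`: a continuous surjection `P ↠ ℤ_ℓ^{2h}`
    let σ : surfaceGen h ≃ Fin (2 * h) := Fintype.equivFinOfCardEq hcard
    let B := Multiplicative (Fin (2 * h) → ℤ_[ℓ])
    let v : surfaceGen h → B := fun x => Multiplicative.ofAdd (Pi.single (σ x) 1)
    let f : Γ →* B :=
      (Literature.Topology.FourManifolds.SurfaceGroup.toCommGroup v).comp e.toMonoidHom
    obtain ⟨F, hFc, hFι⟩ := exists_continuous_extend_profinite hι
      (fun V _ hV => isSigmaInteger_index_padicPi hℓS (2 * h) V hV) f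
    -- the image of `F` is closed and contains the dense lattice generated by the basis vectors
    have hbasis : ∀ i : Fin (2 * h), Multiplicative.ofAdd (Pi.single i (1 : ℤ_[ℓ])) ∈ F.range := by
      intro i
      refine ⟨ι (e.symm (PresentedGroup.of (σ.symm i))), ?_⟩
      rw [hFι]
      simp [f, v]
    have hclosed : IsClosed (F.range : Set B) := by
      rw [MonoidHom.coe_range]
      exact (isCompact_range hFc).isClosed
    -- every integer vector lies in the range
    have hint : ∀ z : Fin (2 * h) → ℤ, (Multiplicative.ofAdd (fun i => (z i : ℤ_[ℓ])) : B) ∈ F.range := by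
      intro z
      have : (fun i => (z i : ℤ_[ℓ])) = ∑ i, z i • Pi.single i (1 : ℤ_[ℓ]) := by
        ext j
        simp [Finset.sum_apply, Pi.single_apply]
      rw [this, ofAdd_sum]
      refine Subgroup.prod_mem _ fun i _ => ?_
      rw [ofAdd_zsmul]
      exact Subgroup.zpow_mem _ (hbasis i) _
    -- the integer vectors are dense in `ℤ_ℓ^{2h}`
    have hdense : Dense (F.range : Set B) := by
      have hpi : Dense (Set.pi Set.univ fun _ : Fin (2 * h) => Set.range (Int.cast : ℤ → ℤ_[ℓ])) :=
        dense_pi Set.univ fun _ _ => PadicInt.denseRange_intCast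
      refine Dense.mono ?_ (show Dense ((Set.pi Set.univ
        fun _ : Fin (2 * h) => Set.range (Int.cast : ℤ → ℤ_[ℓ])) : Set B) from hpi)
      intro x hx
      choose z hz using fun i => (Set.mem_pi.mp hx) i (Set.mem_univ i)
      have : x = (Multiplicative.ofAdd (fun i => (z i : ℤ_[ℓ])) : B) := by
        change x = fun i => (z i : ℤ_[ℓ])
        funext i
        exact (hz i).symm
      rw [this]
      exact hint z
    have hrange : (F.range : Set B) = Set.univ := by
      rw [← hclosed.closure_eq, hdense.closure_eq]
    have hFs : Function.Surjective F := fun b => by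
      have hb : b ∈ (F.range : Set B) := by rw [hrange]; exact Set.mem_univ b
      exact hb
    exact le_freeProlRank_of_surjective ℓ ⟨F, hFc⟩ hFs

/-- **The linear rank formula for the open subgroups of a pro-`Σ` surface group**: for a pro-`Σ`
completion `ι : Γ → P` of `Γ ≅ S_g` (`g ≥ 2`, `P` profinite), a prime `ℓ ∈ Σ` and an open subgroup
`U ⊆ P`, `δ¹_ℓ(U) = 2(g − 1)·[P : U] + 2` — `ι⁻¹U ≅ S_h` with `h − 1 = [P : U](g − 1)` (F_cov,
`surfaceGroupFiniteIndexSubgroup_holds`; `index_comap_of_isOpen`), `ι⁻¹U → U` is a pro-`Σ` completion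
(`restrict_isOpen`), and `freeProlRank_eq_of_surfaceGroup`.
[cite: MochizukiAbsTopI2012, Prop 2.3 (i) p.19] -/
theorem freeProlRank_open_eq_of_surfaceGroup [T2Space P] (hι : IsProSigmaCompletion Sigma ι) {g : ℕ}
    (hg : 2 ≤ g) (e : Γ ≃* SurfaceGroup g) {ℓ : ℕ} [Fact ℓ.Prime] (hℓS : ℓ ∈ Sigma)
    (U : Subgroup P) (hU : IsOpen (U : Set P)) :
    freeProlRank U ℓ = ((2 * (g - 1) * U.index + 2 : ℕ) : ℕ∞) := by
  classical
  -- `ι⁻¹(U) ≅ S_h` by F_cov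
  let S' : Subgroup Γ := U.comap ι
  haveI hS'fi : S'.FiniteIndex := finiteIndex_comap hι U hU
  let K' : Subgroup (SurfaceGroup g) := S'.map (e : Γ →* SurfaceGroup g)
  have hK'idx : K'.index = S'.index := Subgroup.index_map_equiv S' e
  have hK'fi : K'.FiniteIndex := ⟨by rw [hK'idx]; exact hS'fi.index_ne_zero⟩
  obtain ⟨h, hh, ⟨e₂⟩⟩ := surfaceGroupFiniteIndexSubgroup_holds g hg K' hK'fi
  let e' : S' ≃* SurfaceGroup h := (e.subgroupMap S').trans e₂
  -- `ι⁻¹(U) → U` is a pro-`Σ` completion of the profinite group `U`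
  have hιU := restrict_isOpen hι U hU
  have hUc : IsClosed (U : Set P) := Subgroup.isClosed_of_isOpen U hU
  haveI : CompactSpace U := isCompact_iff_compactSpace.mp hUc.isCompact
  have hrank := freeProlRank_eq_of_surfaceGroup hιU e' hℓS
  rw [hrank, hh, hK'idx, index_comap_of_isOpen hι U hU]
  congr 1
  ring

end Profinite

end Literature.AnabelianGeometry.SemiGraphs.SemiGraphOfAnabelioids.IsProSigmaCompletion

end
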